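import Literature.NumberTheory.EllipticCurves.KenkuMinimalLevels
import Literature.NumberTheory.EllipticCurves.MazurTorsionGaloisStructureProofs
import Literature.NumberTheory.EllipticCurves.AnomalousOfRationalTorsionProofs
import Literature.NumberTheory.EllipticCurves.IsogenyQuotientProofs
import Literature.NumberTheory.EllipticCurves.IsogenyCompProofs
import Literature.NumberTheory.EllipticCurves.IsogenyDualProofs
import Literature.NumberTheory.EllipticCurves.IsogenyIdProofs
import Literature.NumberTheory.EllipticCurves.IsogenyVariableChangeProofs
import Literature.NumberTheory.EllipticCurves.GlobalMinimalModelProofs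
import Literature.NumberTheory.EllipticCurves.BSDInvariantsProofs
import Literature.NumberTheory.GaloisRepresentations.ModPCyclotomicCharacterTotallyRealProofs
import HarnessLib

/-!
# Every `ℚ`-isogeny class has a member without rational `p`-torsion (`p` odd), granted Mazur–Kenku

Topic `Literature/NumberTheory/EllipticCurves`; theorems only (no definition, no named fact).

**Theorem** (`exists_isIsogenous_not_dvd_torsionOrder`). Let `p` be an ODD prime and `E/ℚ` an
elliptic curve. Granted the tree's named fact `mazurKenku_exists_cyclic_isogeny` (Mazur 1978 /
Kenku 1982: the degrees of rational cyclic isogenies lie in `{1,…,19,21,25,27,37,43,67,163}`), there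
is an elliptic curve `E'` over `ℚ`, `ℚ`-isogenous to `E`, with `p ∤ #E'(ℚ)_tors`; it may be taken
globally minimal (`exists_isIsogenous_isGloballyMinimal_not_dvd_torsionOrder`).

**Proof (the isogeny walk).** If `p ∣ #E(ℚ)_tors`, Cauchy gives `P ∈ E(ℚ)` of order `p`; its line
`⟨P⟩ ⊂ E[p]` is `Γ_ℚ`-fixed, so `E → E₁ := E/⟨P⟩` is a cyclic `ℚ`-isogeny of degree `p`
(Silverman *AEC* III.4.12, the tree's `exists_isogeny_ker_eq_and_comp_eq_nsmul_holds`). If again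
`p ∣ #E₁(ℚ)_tors`, compose with `E₁ → E₁/⟨R⟩`, and so on. The composite `π_k : E → E_k` has degree
`p^k`, and it stays CYCLIC: by Mazur's display (5.4) (`det ρ̄_{E,p} = χ̄_p`; tree
`smul_sub_cyclotomic_smul_mem_zmultiples`) `Γ_ℚ` acts on `E[p]/⟨P⟩` through the mod-`p` cyclotomic
character, and a complex conjugation `c` has `χ̄_p(c) = −1 ≠ 1` for `p` odd
(`exists_modPCyclotomicCharacterZMod_eq_neg_one`); so no point of `E[p]` outside `⟨P⟩` is mapped
by `π_k` to a RATIONAL point of `E_k` (`Isogeny.apply_eq_zero_of_forall_smul_apply_eq`), whence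
`ker π_{k+1} ∩ E[p] = ⟨P⟩` and `ker π_{k+1} ⊉ E[p]` is cyclic (tree
`isAddCyclic_of_forall_not_geomTorsion_le`). A cyclic `ℚ`-isogeny of degree `p^5 ≥ 243 > 163`
contradicts Mazur–Kenku (`isCyclic_degree_mem_kenkuDegrees_of_mazurKenku`), so the walk stops after
at most four steps at a curve without rational `p`-torsion. (For `p = 2` the statement is false:
`μ₂ = ℤ/2`, e.g. the class 15a.)

Consumer (cell `bsd-potss`, seat kmc): the hypothesis "the class has a `p`-torsion-free member" of
the Kato descent without (12.5.2) (`Summit…Additive.KatoDescentTorsionFree`,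
`Summit…O6.X3WildOfKMCOfReadings.o6Sharp_of_kmc_torsionFree_members`) is thereby a theorem
(modulo Mazur–Kenku), see `Summits/…/Additive/KatoDescentTorsionFreeMember.lean`.

References: B. Mazur, Invent. Math. 44 (1978) Thm. 1; M. A. Kenku, J. Number Theory 15 (1982)
Thm. 1; B. Mazur, Publ. Math. IHÉS 47 (1977) Ch. III §5 (5.4); J. H. Silverman, *AEC* (2009)
III.4.12, III.6.4, III.8.1, IX.6 Ex. 6.4.
-/

noncomputable section

open scoped Classical

namespace Literature.NumberTheory.EllipticCurves

open _root_.WeierstrassCurve Literature.NumberTheory.GaloisRepresentations Field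

section Walk

variable (W : WeierstrassCurve ℚ) [W.IsElliptic] (p : ℕ) [hp : Fact p.Prime]

omit [W.IsElliptic] in
/-- For `p` odd there is `c ∈ Γ_ℚ` (a complex conjugation) whose mod-`p` cyclotomic character is
`≠ 1` (it is `−1`). [folklore] -/
private theorem exists_modPCyclotomicCharacterZMod_ne_one (hp2 : p ≠ 2) :
    ∃ c : absoluteGaloisGroup ℚ, (modPCyclotomicCharacterZMod ℚ p c : ZMod p) ≠ 1 := by
  obtain ⟨c, hc⟩ := exists_modPCyclotomicCharacterZMod_eq_neg_one ℚ p (Rat.castHom ℝ)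
  refine ⟨c, fun h1 ↦ hp2 ?_⟩
  have h : (1 : ZMod p) = -1 := h1.symm.trans hc
  have h2 : ((2 : ℕ) : ZMod p) = 0 := by
    rw [Nat.cast_ofNat]
    calc (2 : ZMod p) = 1 - (-1) := by ring
      _ = 1 - 1 := by rw [← h]
      _ = 0 := sub_self _
  exact (Nat.prime_dvd_prime_iff_eq hp.out Nat.prime_two).mp ((ZMod.natCast_eq_zero_iff 2 p).mp h2)

/-- A multiple of a `Γ`-fixed geometric point is `Γ`-fixed. [folklore] -/
private theorem smul_eq_self_of_mem_zmultiples {V : WeierstrassCurve ℚ} {R x : V.geomPoints}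
    (hR : ∀ σ : absoluteGaloisGroup ℚ, σ • R = R) (hx : x ∈ AddSubgroup.zmultiples R)
    (σ : absoluteGaloisGroup ℚ) : σ • x = x := by
  obtain ⟨k, rfl⟩ := AddSubgroup.mem_zmultiples_iff.mp hx
  rw [← smul_comm k σ R, hR]


/-- **Mazur's (5.4) pushed through an isogeny killing the fixed line.** Let `p` be odd,
`P₁ ∈ E[p]` a non-zero `Γ_ℚ`-fixed point, `π : E → E'` a `ℚ`-isogeny with `π P₁ = O`, and
`S ∈ E[p]` with `π S` fixed by `Γ_ℚ`. Then `π S = O`: by (5.4) `σ S − χ̄_p(σ) S ∈ ⟨P₁⟩`, so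
`π S = σ(π S) = χ̄_p(σ) π S`; choosing `σ` with `χ̄_p(σ) ≠ 1` and using `p · π S = O` gives `π S = O`.
[cite: Mazur1977, Ch. III §5, (5.4), p. 157] -/
theorem Isogeny.apply_eq_zero_of_forall_smul_apply_eq (hp2 : p ≠ 2) {W' : WeierstrassCurve ℚ}
    (π : Isogeny W W') {P₁ : geomTorsion W p} (hP₁0 : P₁ ≠ 0)
    (hP₁fix : ∀ σ : absoluteGaloisGroup ℚ, σ • P₁ = P₁) (hP₁ker : π (P₁ : W.geomPoints) = 0)
    (S : geomTorsion W p)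
    (hS : ∀ σ : absoluteGaloisGroup ℚ, σ • π (S : W.geomPoints) = π (S : W.geomPoints)) :
    π (S : W.geomPoints) = 0 := by
  haveI : NeZero (p : ℚ) := ⟨Nat.cast_ne_zero.mpr hp.out.ne_zero⟩
  obtain ⟨c, hc⟩ := exists_modPCyclotomicCharacterZMod_ne_one p hp2
  set v : ℕ := ((modPCyclotomicCharacterZMod ℚ p c : (ZMod p)ˣ) : ZMod p).val with hv
  -- (5.4): `c • S - v • S ∈ ⟨P₁⟩`
  obtain ⟨k, hk⟩ :=
    AddSubgroup.mem_zmultiples_iff.mp (smul_sub_cyclotomic_smul_mem_zmultiples W p hP₁0 hP₁fix c S)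
  have hk' : k • (P₁ : W.geomPoints) = c • (S : W.geomPoints) - v • (S : W.geomPoints) := by
    have h := congrArg Subtype.val hk
    simpa only [AddSubgroupClass.coe_zsmul, AddSubgroupClass.coe_sub, AddSubgroupClass.coe_nsmul,
      AddSubgroup.torsionBy.coe_smul] using h
  -- apply `π`: `π S = v • π S`
  have hπ : π (S : W.geomPoints) = v • π (S : W.geomPoints) := by
    have h1 : π (k • (P₁ : W.geomPoints)) = 0 := by rw [map_zsmul, hP₁ker, zsmul_zero]
    rw [hk', map_sub, map_nsmul, sub_eq_zero, Isogeny.map_smul, hS c] at h1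
    exact h1
  -- `p • π S = 0`
  set x : W'.geomPoints := π (S : W.geomPoints) with hx
  have hpx : p • x = 0 := by
    have hS0 : p • (S : W.geomPoints) = 0 := AddSubgroup.torsionBy.nsmul_iff.mp S.2
    rw [hx, ← map_nsmul, hS0, map_zero]
  have hord : addOrderOf x ∣ p := addOrderOf_dvd_of_nsmul_eq_zero hpx
  rcases (Nat.dvd_prime hp.out).mp hord with h1 | hP
  · exact AddMonoid.addOrderOf_eq_one_iff.mp h1
  · exfalso
    apply hc
    -- `(v - 1) • x = 0`, so `p ∣ v - 1`, so `χ̄_p(c) = v = 1` in `ZMod p`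
    have hvx : ((v : ℤ) - 1) • x = 0 := by
      have : ((v : ℤ) - 1) • x = (v : ℤ) • x - (1 : ℤ) • x := sub_zsmul x _ _
      rw [this, one_zsmul, natCast_zsmul, ← hπ]
      exact sub_self x
    have hdvd : (p : ℤ) ∣ (v : ℤ) - 1 := by
      rw [← hP]
      exact (addOrderOf_dvd_iff_zsmul_eq_zero).mpr hvx
    have h0 : (((v : ℤ) - 1 : ℤ) : ZMod p) = 0 := (ZMod.intCast_zmod_eq_zero_iff_dvd _ p).mpr hdvd
    have hv1 : ((v : ℕ) : ZMod p) = 1 := by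
      rw [Int.cast_sub, Int.cast_one, Int.cast_natCast, sub_eq_zero] at h0
      exact h0
    rwa [hv, ZMod.natCast_zmod_val] at hv1


omit [W.IsElliptic] in
/-- A subgroup of `E(ℚ̄)` of prime order `p` contains no full `ℓ`-torsion `E[ℓ] ≅ (ℤ/ℓ)²`
(`#E[ℓ] = ℓ²`, Silverman *AEC* III.6.4). [cite: SilvermanAEC2009, Cor. III.6.4(b)] -/
theorem not_geomTorsion_le_of_natCard_eq {V : WeierstrassCurve ℚ} [V.IsElliptic]
    (H : AddSubgroup V.geomPoints) (hH : Nat.card H = p) {ℓ : ℕ} (hℓ : ℓ.Prime) :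
    ¬ geomTorsion V (ℓ : ℤ) ≤ H := by
  intro hle
  have hdvd : ℓ ^ 2 ∣ p := by
    have h := AddSubgroup.card_dvd_of_le hle
    rwa [natCard_geomTorsion_eq_sq V (Nat.cast_ne_zero.mpr hℓ.ne_zero : (ℓ : ℚ) ≠ 0), hH] at h
  have hℓp : ℓ = p :=
    (Nat.prime_dvd_prime_iff_eq hℓ hp.out).mp (dvd_trans (dvd_pow_self ℓ two_ne_zero) hdvd)
  subst hℓp
  have h1 : ℓ * ℓ ∣ ℓ * 1 := by rwa [mul_one, ← sq]
  exact hℓ.ne_one (Nat.dvd_one.mp (Nat.dvd_of_mul_dvd_mul_left hℓ.pos h1))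

/-- **The isogeny walk, first step.** If `p ∣ #E(ℚ)_tors` there are a `ℚ`-isogeny `π : E → E₁`,
cyclic of degree `p`, and a non-zero `Γ_ℚ`-fixed `P₁ ∈ E[p]` with `ker π ∩ E[p] = ⟨P₁⟩ ∋ P₁`
(`E₁ = E/⟨P₁⟩`, Silverman *AEC* III.4.12 / Rem. III.4.13.2). [cite: SilvermanAEC2009, Prop. III.4.12 with Rem. III.4.13.2] -/
theorem Isogeny.exists_walk_base (htors : p ∣ W.torsionOrder) :
    ∃ (W' : WeierstrassCurve ℚ) (_ : W'.IsElliptic) (π : Isogeny W W') (P₁ : geomTorsion W p),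
      π.IsCyclic ∧ π.degree = p ^ (0 + 1) ∧ P₁ ≠ 0 ∧
      (∀ σ : absoluteGaloisGroup ℚ, σ • P₁ = P₁) ∧ π (P₁ : W.geomPoints) = 0 ∧
      ∀ Q : geomTorsion W p, π (Q : W.geomPoints) = 0 →
        (Q : W.geomPoints) ∈ AddSubgroup.zmultiples (P₁ : W.geomPoints) := by
  obtain ⟨R, hR⟩ := exists_addOrderOf_eq_of_dvd_torsionOrder W p htors
  obtain ⟨P₁, -, hP₁0, hP₁fix⟩ := exists_geomTorsion_of_addOrderOf_eq W hR
  set S : AddSubgroup W.geomPoints := AddSubgroup.zmultiples (P₁ : W.geomPoints) with hSdef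
  have hP₁0' : (P₁ : W.geomPoints) ≠ 0 := fun h ↦ hP₁0 (Subtype.ext h)
  have hpP₁ : p • (P₁ : W.geomPoints) = 0 := AddSubgroup.torsionBy.nsmul_iff.mp P₁.2
  have hord : addOrderOf (P₁ : W.geomPoints) = p := addOrderOf_eq_prime hpP₁ hP₁0'
  have hScard : Nat.card S = p := by rw [hSdef, Nat.card_zmultiples, hord]
  have hSfin : (S : Set W.geomPoints).Finite :=
    Nat.finite_of_card_ne_zero (hScard.symm ▸ hp.out.ne_zero)
  have hP₁fix' : ∀ σ : absoluteGaloisGroup ℚ, σ • (P₁ : W.geomPoints) = P₁ := fun σ ↦ by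
    rw [← AddSubgroup.torsionBy.coe_smul, hP₁fix σ]
  have hSstab : ∀ (σ : absoluteGaloisGroup ℚ) (x : W.geomPoints), x ∈ S → σ • x ∈ S :=
    fun σ x hx ↦ by rw [smul_eq_self_of_mem_zmultiples hP₁fix' hx σ]; exact hx
  obtain ⟨W', hW', g, -, hgker, -, -⟩ :=
    W.exists_isogeny_ker_eq_and_comp_eq_nsmul_holds S hSfin hSstab
  haveI := hW'
  refine ⟨W', hW', g, P₁, ?_, ?_, hP₁0, hP₁fix, ?_, ?_⟩
  · -- cyclic: `ker g = ⟨P₁⟩` has order `p`, so contains no `E[ℓ]`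
    unfold Isogeny.IsCyclic
    rw [hgker]
    haveI : Finite S := Nat.finite_of_card_ne_zero (hScard.symm ▸ hp.out.ne_zero)
    exact isAddCyclic_of_forall_not_geomTorsion_le W S
      (fun ℓ hℓ ↦ not_geomTorsion_le_of_natCard_eq p S hScard hℓ)
  · show Nat.card g.toAddMonoidHom.ker = p ^ (0 + 1)
    rw [hgker, hScard, zero_add, pow_one]
  · show (P₁ : W.geomPoints) ∈ g.toAddMonoidHom.ker
    rw [hgker, hSdef]
    exact AddSubgroup.mem_zmultiples _
  · intro Q hQ
    have h : (Q : W.geomPoints) ∈ g.toAddMonoidHom.ker := hQ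
    rwa [hgker, hSdef] at h

/-- **The isogeny walk, inductive step.** Given a cyclic `ℚ`-isogeny `π : E → E'` of degree `p^k`
with `ker π ∩ E[p] = ⟨P₁⟩ ∋ P₁` for a `Γ_ℚ`-fixed `P₁ ≠ O`, and `p ∣ #E'(ℚ)_tors`: composing with
`E' → E'/⟨R⟩` (`R ∈ E'(ℚ)` of order `p`) gives a CYCLIC `ℚ`-isogeny of degree `p^{k+1}` with the
same property — its kernel meets `E[p]` in `⟨P₁⟩` only, by
`Isogeny.apply_eq_zero_of_forall_smul_apply_eq` (Mazur's (5.4) with `χ̄_p ≢ 1`, `p` odd).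
[cite: SilvermanAEC2009, Prop. III.4.12 with Rem. III.4.13.2] [cite: Mazur1977, Ch. III §5, (5.4), p. 157] -/
theorem Isogeny.exists_walk_step (hp2 : p ≠ 2) {W' : WeierstrassCurve ℚ} [W'.IsElliptic]
    (π : Isogeny W W') {k : ℕ} (hcyc : π.IsCyclic) (hdeg : π.degree = p ^ k)
    {P₁ : geomTorsion W p} (hP₁0 : P₁ ≠ 0) (hP₁fix : ∀ σ : absoluteGaloisGroup ℚ, σ • P₁ = P₁)
    (hP₁ker : π (P₁ : W.geomPoints) = 0)
    (hker : ∀ Q : geomTorsion W p, π (Q : W.geomPoints) = 0 →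
      (Q : W.geomPoints) ∈ AddSubgroup.zmultiples (P₁ : W.geomPoints))
    (htors : p ∣ W'.torsionOrder) :
    ∃ (W'' : WeierstrassCurve ℚ) (_ : W''.IsElliptic) (π' : Isogeny W W''),
      π'.IsCyclic ∧ π'.degree = p ^ (k + 1) ∧ π' (P₁ : W.geomPoints) = 0 ∧
      ∀ Q : geomTorsion W p, π' (Q : W.geomPoints) = 0 →
        (Q : W.geomPoints) ∈ AddSubgroup.zmultiples (P₁ : W.geomPoints) := by
  have _ := hcyc
  -- a rational point of order `p` on `W'` and its `Γ_ℚ`-fixed line `S = ⟨R̄⟩`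
  obtain ⟨R, hR⟩ := exists_addOrderOf_eq_of_dvd_torsionOrder W' p htors
  obtain ⟨Rb, -, hRb0, hRbfix⟩ := exists_geomTorsion_of_addOrderOf_eq W' hR
  set S : AddSubgroup W'.geomPoints := AddSubgroup.zmultiples (Rb : W'.geomPoints) with hSdef
  have hRb0' : (Rb : W'.geomPoints) ≠ 0 := fun h ↦ hRb0 (Subtype.ext h)
  have hpRb : p • (Rb : W'.geomPoints) = 0 := AddSubgroup.torsionBy.nsmul_iff.mp Rb.2
  have hordRb : addOrderOf (Rb : W'.geomPoints) = p := addOrderOf_eq_prime hpRb hRb0'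
  have hScard : Nat.card S = p := by rw [hSdef, Nat.card_zmultiples, hordRb]
  have hSfin : (S : Set W'.geomPoints).Finite :=
    Nat.finite_of_card_ne_zero (hScard.symm ▸ hp.out.ne_zero)
  have hRbfix' : ∀ σ : absoluteGaloisGroup ℚ, σ • (Rb : W'.geomPoints) = Rb := fun σ ↦ by
    rw [← AddSubgroup.torsionBy.coe_smul, hRbfix σ]
  have hSfix : ∀ (σ : absoluteGaloisGroup ℚ) (x : W'.geomPoints), x ∈ S → σ • x = x :=
    fun σ x hx ↦ smul_eq_self_of_mem_zmultiples hRbfix' hx σ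
  have hSstab : ∀ (σ : absoluteGaloisGroup ℚ) (x : W'.geomPoints), x ∈ S → σ • x ∈ S :=
    fun σ x hx ↦ by rw [hSfix σ x hx]; exact hx
  -- the quotient `W'' = W'/S` and the composite `π' = g ∘ π`
  obtain ⟨W'', hW'', g, -, hgker, -, -⟩ :=
    W'.exists_isogeny_ker_eq_and_comp_eq_nsmul_holds S hSfin hSstab
  haveI := hW''
  -- degree `p^{k+1}`
  have hdeg' : Nat.card (g.comp π).toAddMonoidHom.ker = p ^ (k + 1) := by
    have h1 : Nat.card (g.comp π).toAddMonoidHom.ker = Nat.card g.toAddMonoidHom.ker * π.degree :=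
      AddMonoidHom.natCard_ker_comp_of_surjective g.toAddMonoidHom π.toAddMonoidHom π.surjective
    rw [h1, hgker, hScard, hdeg, pow_succ, mul_comm]
  -- the kernel meets `E[p]` in `⟨P₁⟩` only
  have hkey : ∀ Q : geomTorsion W p, (g.comp π) (Q : W.geomPoints) = 0 →
      (Q : W.geomPoints) ∈ AddSubgroup.zmultiples (P₁ : W.geomPoints) := by
    intro Q hQ
    have hmem : π (Q : W.geomPoints) ∈ S := by
      rw [← hgker]
      exact hQ
    exact hker Q (Isogeny.apply_eq_zero_of_forall_smul_apply_eq W p hp2 π hP₁0 hP₁fix hP₁ker Q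
      (fun σ ↦ hSfix σ _ hmem))
  refine ⟨W'', hW'', g.comp π, ?_, hdeg', ?_, hkey⟩
  · -- cyclic: a full `E[ℓ]` inside the kernel forces `ℓ = p` and then `E[p] ⊆ ⟨P₁⟩`
    unfold Isogeny.IsCyclic
    refine isAddCyclic_of_forall_not_geomTorsion_le W _ (fun ℓ hℓ hle ↦ ?_)
    have hdvd : ℓ ^ 2 ∣ p ^ (k + 1) := by
      have h := AddSubgroup.card_dvd_of_le hle
      rwa [natCard_geomTorsion_eq_sq W (Nat.cast_ne_zero.mpr hℓ.ne_zero : (ℓ : ℚ) ≠ 0), hdeg'] at h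
    have hℓp : ℓ = p := (Nat.prime_dvd_prime_iff_eq hℓ hp.out).mp
      (hℓ.dvd_of_dvd_pow (dvd_trans (dvd_pow_self ℓ two_ne_zero) hdvd))
    subst hℓp
    have hP₁0' : (P₁ : W.geomPoints) ≠ 0 := fun h ↦ hP₁0 (Subtype.ext h)
    have hpP₁ : ℓ • (P₁ : W.geomPoints) = 0 := AddSubgroup.torsionBy.nsmul_iff.mp P₁.2
    have hT : Nat.card (AddSubgroup.zmultiples (P₁ : W.geomPoints)) = ℓ := by
      rw [Nat.card_zmultiples, addOrderOf_eq_prime hpP₁ hP₁0']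
    refine not_geomTorsion_le_of_natCard_eq ℓ (AddSubgroup.zmultiples (P₁ : W.geomPoints)) hT hℓ
      (fun Q hQ ↦ hkey ⟨Q, hQ⟩ (hle hQ))
  · rw [Isogeny.comp_apply, hP₁ker, map_zero]

end Walk

section Main

variable (W : WeierstrassCurve ℚ) [W.IsElliptic] (p : ℕ) [hp : Fact p.Prime]

/-- **Every `ℚ`-isogeny class contains a curve without rational `p`-torsion (`p` odd), granted
Mazur–Kenku.** For an elliptic curve `E/ℚ` and an odd prime `p` there is an elliptic curve `E'/ℚ`,
`ℚ`-isogenous to `E`, with `p ∤ #E'(ℚ)_tors`. Otherwise the isogeny walk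
(`Isogeny.exists_walk_base` / `Isogeny.exists_walk_step`) produces cyclic `ℚ`-isogenies out of `E`
of every degree `p^k`, and `p^5 ≥ 243 > 163` is not a Mazur–Kenku degree
(`isCyclic_degree_mem_kenkuDegrees_of_mazurKenku`). False for `p = 2` (class 15a).
[cite: SilvermanAEC2009, IX.6 Example 6.4] [cite: Mazur1978, Thm 1] [cite: Kenku1982, Thm. 1] -/
theorem exists_isIsogenous_not_dvd_torsionOrder (hMK : mazurKenku_exists_cyclic_isogeny)
    (hp2 : p ≠ 2) :
    ∃ (W' : WeierstrassCurve ℚ) (_ : W'.IsElliptic), IsIsogenous W W' ∧ ¬ p ∣ W'.torsionOrder := by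
  by_contra hne
  push Not at hne
  have walk : ∀ k : ℕ, ∃ (W' : WeierstrassCurve ℚ) (_ : W'.IsElliptic) (π : Isogeny W W')
      (P₁ : geomTorsion W p), π.IsCyclic ∧ π.degree = p ^ (k + 1) ∧ P₁ ≠ 0 ∧
      (∀ σ : absoluteGaloisGroup ℚ, σ • P₁ = P₁) ∧ π (P₁ : W.geomPoints) = 0 ∧
      ∀ Q : geomTorsion W p, π (Q : W.geomPoints) = 0 →
        (Q : W.geomPoints) ∈ AddSubgroup.zmultiples (P₁ : W.geomPoints) := by
    intro k
    induction k with
    | zero => exact Isogeny.exists_walk_base W p (hne W inferInstance (isIsogenous_self W))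
    | succ k ih =>
      obtain ⟨W', hW', π, P₁, hcyc, hdeg, hP₁0, hfix, hker1, hker⟩ := ih
      haveI := hW'
      obtain ⟨W'', hW'', π', hcyc', hdeg', hker1', hker'⟩ :=
        Isogeny.exists_walk_step W p hp2 π hcyc hdeg hP₁0 hfix hker1 hker (hne W' hW' ⟨π⟩)
      exact ⟨W'', hW'', π', P₁, hcyc', hdeg', hP₁0, hfix, hker1', hker'⟩
  obtain ⟨W', hW', π, -, hcyc, hdeg, -⟩ := walk 4
  haveI := hW'
  have hle := le_of_mem_kenkuDegrees (isCyclic_degree_mem_kenkuDegrees_of_mazurKenku hMK π hcyc)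
  rw [hdeg] at hle
  have h3 : 3 ≤ p := Nat.succ_le_of_lt (lt_of_le_of_ne hp.out.two_le (Ne.symm hp2))
  have h5 : 3 ^ 5 ≤ p ^ (4 + 1) := Nat.pow_le_pow_left h3 5
  omega

/-- **The `p`-torsion-free member may be taken globally minimal** (Néron / Silverman *AEC*
VIII.8.3: a global minimal model exists over `ℚ`; a change of variables is an isogeny and
preserves `#E(ℚ)_tors`). [cite: SilvermanAEC2009, VIII.8, Cor. 8.3, p. 213] -/
theorem exists_isIsogenous_isGloballyMinimal_not_dvd_torsionOrder
    (hMK : mazurKenku_exists_cyclic_isogeny) (hp2 : p ≠ 2) :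
    ∃ (W' : WeierstrassCurve ℚ) (_ : W'.IsElliptic) (_ : W'.IsGloballyMinimal),
      IsIsogenous W W' ∧ ¬ p ∣ W'.torsionOrder := by
  obtain ⟨W', hW', hiso, htors⟩ := exists_isIsogenous_not_dvd_torsionOrder W p hMK hp2
  haveI := hW'
  obtain ⟨C, hC⟩ := hasGlobalMinimalModel_rat_holds W'
  refine ⟨C • W', inferInstance, hC, hiso.trans' (isIsogenous_smul W' C), ?_⟩
  rw [show (C • W').torsionOrder = W'.torsionOrder from torsionOrder_variableChange_holds W' C]
  exact htors

end Main

end Literature.NumberTheory.EllipticCurves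

end
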